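import Literature.MathematicalPhysics.QuantumFieldTheory.QCDGammaFiveConjugation
import HarnessLib

/-!
# Crux `TorusHalfSpectrum` (stmt-QuantumFields-9508), line `registered` (`Lines/birth.lean`, reshape v6) —
# stub `stub_gammaFiveConj_exists` (K0): a `γ₅`-conjugation exists on every torus quark Grassmann algebra

Stub K0 of the birth skeleton of the crux
`Summit.QuantumFields.QCD.Theses.QuarksNoInfraredClause.TorusHalfSpectrum`: on the quark Grassmann algebra
`FermiAlg Nf S` of every periodic four-torus of side `S` and every flavour number `N_f` there is a map `K`
which is multiplicative, additive, complex-ANTIlinear, unital, and acts on the generators by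

  `K ψ_{f,x,a,α} = −∑_σ (γ₅)_{σα} ψ̄_{f,x,a,σ}`,   `K ψ̄_{f,x,a,α} = ∑_σ (γ₅)_{ασ} ψ_{f,x,a,σ}`

(the six CLAUSES of the skeleton's `IsGammaFiveConj K`).  The witness is the Literature `γ₅`-conjugation
`torusK = Λ(K₀) ∘ conj` of `QCDGammaFiveConjugation.lean` (`K₀ = torusKLin`): multiplicative by `torusK_mul`,
additive and `conj`-semilinear as a bundled `→ₗ⋆[ℂ]` map, unital by `torusK_one`; the generator values are
read off `torusK_ι` and the coordinate formulae `torusKLin_apply_inl/inr` (this file's `torusKLin_single_inr/inl`,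
`torusK_q`, `torusK_qbar`, the `γ₅` analogue of `torusTheta_q`/`torusTheta_qbar` of
`QCDTimeReflectionProofs.lean`, with no site reflection and no order reversal).

The file also proves, for the three sibling stubs K1, K1', K2, the UNIQUENESS of a `γ₅`-conjugation
(`gammaFiveConj_unique`): two maps with the six clauses agree on the whole Grassmann algebra
(`ExteriorAlgebra.induction`: scalars by antilinearity and unitality, degree one by additivity over the
`Pi.single` basis and the generator clauses, products and sums by the first two clauses), and its corollary
`eq_torusK_of_clauses`: every `γ₅`-conjugation IS `torusK`.

Everything used is proved in the tree (no named fact).  Sources: I. Montvay, G. Münster, *Quantum Fields on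
a Lattice* (CUP 1994) §4.2 (4.35) (`γ₅`-hermiticity), §5.1.2 (5.15); the packaging of `γ₅`-hermiticity as an
antilinear Grassmann ring map is folklore.
-/

noncomputable section

namespace Summit.QuantumFields.QCD.Cruxes.TorusHalfSpectrum.Birth.GammaFiveConjExists

open scoped BigOperators ComplexConjugate
open Literature.Probability.LatticeModels Literature.MathematicalPhysics.QuantumFieldTheory
  Literature.MathematicalPhysics.QuantumLattice

variable {Nf L : ℕ} [NeZero L]

/-! ### The `γ₅`-conjugation on generators -/

/-- The substitution `K₀` on the coefficient vector of `ψ_{f,x,a,α}`: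
`e_{ψ,(f,x,a,α)} ↦ ∑_β (−γ₅)_{βα} e_{ψ̄,(f,x,a,β)}`. [folklore] -/
theorem torusKLin_single_inr (f : Fin Nf) (x : TorusSite 4 L) (a : Fin 3) (α : Fin 4) :
    torusKLin (Nf := Nf) (L := L) (Pi.single (toLex (Sum.inr (quarkEquiv (f, (x, a, α))))) 1) =
      ∑ β : Fin 4, (-gammaFive β α) •
        Pi.single (toLex (Sum.inl (quarkEquiv (Nf := Nf) (L := L) (f, (x, a, β))))) (1 : ℂ) := by
  funext w
  obtain ⟨y, rfl⟩ : ∃ y, toLex y = w := ⟨ofLex w, rfl⟩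
  rcases y with i | i
  · obtain ⟨⟨f', x', a', β'⟩, rfl⟩ := quarkEquiv.surjective i
    rw [torusKLin_apply_inl]
    simp only [Finset.sum_apply, Pi.smul_apply, Pi.single_apply, Sum.inr.injEq,
      Sum.inl.injEq, EmbeddingLike.apply_eq_iff_eq, Prod.mk.injEq, smul_eq_mul, mul_ite, mul_one,
      mul_zero]
    by_cases hf : f' = f
    · by_cases ha : a' = a
      · by_cases hx : x' = x
        · subst hf ha hx
          simp [Finset.sum_ite_eq']
        · simp [hx]
      · simp [ha]
    · simp [hf]
  · obtain ⟨v, rfl⟩ := quarkEquiv.surjective i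
    rw [torusKLin_apply_inr]
    simp only [Finset.sum_apply, Pi.smul_apply, Pi.single_apply, toLex_inj, reduceCtorEq, if_false,
      mul_zero, Finset.sum_const_zero, smul_eq_mul]

/-- The substitution `K₀` on the coefficient vector of `ψ̄_{f,x,a,α}`:
`e_{ψ̄,(f,x,a,α)} ↦ ∑_β (γ₅)_{αβ} e_{ψ,(f,x,a,β)}`. [folklore] -/
theorem torusKLin_single_inl (f : Fin Nf) (x : TorusSite 4 L) (a : Fin 3) (α : Fin 4) :
    torusKLin (Nf := Nf) (L := L) (Pi.single (toLex (Sum.inl (quarkEquiv (f, (x, a, α))))) 1) =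
      ∑ β : Fin 4, (gammaFive α β) •
        Pi.single (toLex (Sum.inr (quarkEquiv (Nf := Nf) (L := L) (f, (x, a, β))))) (1 : ℂ) := by
  funext w
  obtain ⟨y, rfl⟩ : ∃ y, toLex y = w := ⟨ofLex w, rfl⟩
  rcases y with i | i
  · obtain ⟨v, rfl⟩ := quarkEquiv.surjective i
    rw [torusKLin_apply_inl]
    simp only [Finset.sum_apply, Pi.smul_apply, Pi.single_apply, toLex_inj, reduceCtorEq, if_false,
      mul_zero, Finset.sum_const_zero, smul_eq_mul]
  · obtain ⟨⟨f', x', a', β'⟩, rfl⟩ := quarkEquiv.surjective i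
    rw [torusKLin_apply_inr]
    simp only [Finset.sum_apply, Pi.smul_apply, Pi.single_apply, Sum.inr.injEq,
      Sum.inl.injEq, EmbeddingLike.apply_eq_iff_eq, Prod.mk.injEq, smul_eq_mul, mul_ite, mul_one,
      mul_zero]
    by_cases hf : f' = f
    · by_cases ha : a' = a
      · by_cases hx : x' = x
        · subst hf ha hx
          simp [Finset.sum_ite_eq']
        · simp [hx]
      · simp [ha]
    · simp [hf]

/-- **`K ψ = −ψ̄ γ₅` on the torus**: `K ψ_{f,x,a,α} = −∑_σ (γ₅)_{σα} ψ̄_{f,x,a,σ}`. [folklore] -/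
theorem torusK_q (f : Fin Nf) (x : TorusSite 4 L) (a : Fin 3) (α : Fin 4) :
    torusK (q (f, (x, a, α))) =
      -∑ σ : Fin 4, gammaFive σ α • qbar (Nf := Nf) (L := L) (f, (x, a, σ)) := by
  simp only [q, qbar, psi, psiBar, GrassmannAlgebra.gen, torusK_ι, ← Pi.single_star, star_one,
    torusKLin_single_inr, neg_smul, Finset.sum_neg_distrib, map_neg, map_sum, map_smul]

/-- **`K ψ̄ = γ₅ ψ` on the torus**: `K ψ̄_{f,x,a,α} = ∑_σ (γ₅)_{ασ} ψ_{f,x,a,σ}`. [folklore] -/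
theorem torusK_qbar (f : Fin Nf) (x : TorusSite 4 L) (a : Fin 3) (α : Fin 4) :
    torusK (qbar (f, (x, a, α))) =
      ∑ σ : Fin 4, gammaFive α σ • q (Nf := Nf) (L := L) (f, (x, a, σ)) := by
  simp only [q, qbar, psi, psiBar, GrassmannAlgebra.gen, torusK_ι, ← Pi.single_star, star_one,
    torusKLin_single_inl, map_sum, map_smul]

/-- `K ψ_v` for an arbitrary quark variable `v` (the fifth clause of a `γ₅`-conjugation). [folklore] -/
theorem torusK_q' (v : QuarkVar Nf L) :
    torusK (q v) = -∑ σ : Fin 4, gammaFive σ v.2.2.2 • qbar (v.1, (v.2.1, v.2.2.1, σ)) :=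
  torusK_q v.1 v.2.1 v.2.2.1 v.2.2.2

/-- `K ψ̄_v` for an arbitrary quark variable `v` (the sixth clause of a `γ₅`-conjugation). [folklore] -/
theorem torusK_qbar' (v : QuarkVar Nf L) :
    torusK (qbar v) = ∑ σ : Fin 4, gammaFive v.2.2.2 σ • q (v.1, (v.2.1, v.2.2.1, σ)) :=
  torusK_qbar v.1 v.2.1 v.2.2.1 v.2.2.2

/-- `K` is additive (it is a bundled semilinear map). [folklore] -/
theorem torusK_add (x y : FermiAlg Nf L) : torusK (x + y) = torusK x + torusK y :=
  map_add torusK x y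

/-- `K` is complex-antilinear (it is a bundled `conj`-semilinear map). [folklore] -/
theorem torusK_smul (c : ℂ) (x : FermiAlg Nf L) : torusK (c • x) = starRingEnd ℂ c • torusK x :=
  LinearMap.map_smulₛₗ torusK c x

/-! ### Uniqueness of a `γ₅`-conjugation -/

/-- **Uniqueness of the `γ₅`-conjugation**: two maps of the torus quark Grassmann algebra which are
multiplicative, additive, antilinear, unital and take the `γ₅`-conjugation values on the generators
`ψ_v`, `ψ̄_v` agree everywhere (`ExteriorAlgebra.induction`; the algebra is generated by the `ψ̄_v, ψ_v`).
Stated clause by clause so that the sibling stub files can feed it the unfolded characterisation. [folklore] -/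
theorem gammaFiveConj_unique {Nf S : ℕ} [NeZero S] {K K' : FermiAlg Nf S → FermiAlg Nf S}
    (hmul : ∀ x y, K (x * y) = K x * K y) (hadd : ∀ x y, K (x + y) = K x + K y)
    (hsmul : ∀ (c : ℂ) (x : FermiAlg Nf S), K (c • x) = starRingEnd ℂ c • K x) (hone : K 1 = 1)
    (hq : ∀ v : QuarkVar Nf S, K (q v) =
      -∑ σ : Fin 4, gammaFive σ v.2.2.2 • qbar (v.1, (v.2.1, v.2.2.1, σ)))
    (hqbar : ∀ v : QuarkVar Nf S, K (qbar v) =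
      ∑ σ : Fin 4, gammaFive v.2.2.2 σ • q (v.1, (v.2.1, v.2.2.1, σ)))
    (hmul' : ∀ x y, K' (x * y) = K' x * K' y) (hadd' : ∀ x y, K' (x + y) = K' x + K' y)
    (hsmul' : ∀ (c : ℂ) (x : FermiAlg Nf S), K' (c • x) = starRingEnd ℂ c • K' x) (hone' : K' 1 = 1)
    (hq' : ∀ v : QuarkVar Nf S, K' (q v) =
      -∑ σ : Fin 4, gammaFive σ v.2.2.2 • qbar (v.1, (v.2.1, v.2.2.1, σ)))
    (hqbar' : ∀ v : QuarkVar Nf S, K' (qbar v) =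
      ∑ σ : Fin 4, gammaFive v.2.2.2 σ • q (v.1, (v.2.1, v.2.2.1, σ))) :
    ∀ a, K a = K' a := by
  intro a
  induction a using ExteriorAlgebra.induction with
  | algebraMap c => rw [Algebra.algebraMap_eq_smul_one, hsmul, hsmul', hone, hone']
  | ι v =>
    -- the two maps agree on the generators `θ_w = ι (e_w)`, `w = ψ̄_i` or `ψ_i`
    have hgen : ∀ w : FermiIdx Nf S ⊕ₗ FermiIdx Nf S,
        K (ExteriorAlgebra.ι ℂ (Pi.single w (1 : ℂ))) = K' (ExteriorAlgebra.ι ℂ (Pi.single w (1 : ℂ))) := by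
      intro w
      obtain ⟨y, rfl⟩ : ∃ y, toLex y = w := ⟨ofLex w, rfl⟩
      rcases y with i | i
      · have hi : ExteriorAlgebra.ι ℂ (Pi.single (toLex (Sum.inl i)) (1 : ℂ)) =
            qbar (quarkEquiv.symm i : QuarkVar Nf S) := by
          simp only [qbar, psiBar, GrassmannAlgebra.gen, Equiv.apply_symm_apply]
        rw [hi, hqbar, hqbar']
      · have hi : ExteriorAlgebra.ι ℂ (Pi.single (toLex (Sum.inr i)) (1 : ℂ)) =
            q (quarkEquiv.symm i : QuarkVar Nf S) := by
          simp only [q, psi, GrassmannAlgebra.gen, Equiv.apply_symm_apply]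
        rw [hi, hq, hq']
    -- hence, by additivity and antilinearity, on every degree-one element
    have hext : (AddMonoidHom.mk' K hadd).comp (ExteriorAlgebra.ι ℂ).toAddMonoidHom =
        (AddMonoidHom.mk' K' hadd').comp (ExteriorAlgebra.ι ℂ).toAddMonoidHom := by
      refine AddMonoidHom.functions_ext _ _ _ fun w c => ?_
      have hc : (Pi.single w c : FermiIdx Nf S ⊕ₗ FermiIdx Nf S → ℂ) = c • Pi.single w (1 : ℂ) := by
        rw [← Pi.single_smul', smul_eq_mul, mul_one]
      simp only [AddMonoidHom.comp_apply, LinearMap.toAddMonoidHom_coe, AddMonoidHom.mk'_apply, hc,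
        map_smul, hsmul, hsmul', hgen]
    exact DFunLike.congr_fun hext v
  | mul a b ha hb => rw [hmul, hmul', ha, hb]
  | add a b ha hb => rw [hadd, hadd', ha, hb]

/-- **Every `γ₅`-conjugation is `torusK`**: a map of the torus quark Grassmann algebra with the six
clauses (multiplicative, additive, antilinear, unital, `γ₅` generator values) coincides with the
Literature `torusK = Λ(K₀) ∘ conj`. [folklore] -/
theorem eq_torusK_of_clauses {Nf S : ℕ} [NeZero S] {K : FermiAlg Nf S → FermiAlg Nf S}
    (hmul : ∀ x y, K (x * y) = K x * K y) (hadd : ∀ x y, K (x + y) = K x + K y)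
    (hsmul : ∀ (c : ℂ) (x : FermiAlg Nf S), K (c • x) = starRingEnd ℂ c • K x) (hone : K 1 = 1)
    (hq : ∀ v : QuarkVar Nf S, K (q v) =
      -∑ σ : Fin 4, gammaFive σ v.2.2.2 • qbar (v.1, (v.2.1, v.2.2.1, σ)))
    (hqbar : ∀ v : QuarkVar Nf S, K (qbar v) =
      ∑ σ : Fin 4, gammaFive v.2.2.2 σ • q (v.1, (v.2.1, v.2.2.1, σ))) :
    ∀ a, K a = torusK a :=
  gammaFiveConj_unique hmul hadd hsmul hone hq hqbar torusK_mul torusK_add torusK_smul torusK_one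
    torusK_q' torusK_qbar'

/-! ### The registered stub -/

/-- **Stub K0 of the birth skeleton of `TorusHalfSpectrum` (= `ConjugationExistsStmt` unfolded): a
`γ₅`-conjugation exists on every torus quark Grassmann algebra.**  Witness: the Literature
`torusK = Λ(K₀) ∘ conj` (`QCDGammaFiveConjugation.lean`): multiplicative (`torusK_mul`), additive, antilinear
(`LinearMap.map_smulₛₗ`), unital (`torusK_one`), with the generator values `torusK_q'`/`torusK_qbar'` read off
`torusK_ι`/`torusKLin`. -/
theorem stub_gammaFiveConj_exists :
    ∀ (Nf S : ℕ) [NeZero S], ∃ K : FermiAlg Nf S → FermiAlg Nf S,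
      (∀ x y, K (x * y) = K x * K y) ∧ (∀ x y, K (x + y) = K x + K y) ∧
        (∀ (c : ℂ) (x : FermiAlg Nf S), K (c • x) = starRingEnd ℂ c • K x) ∧ K 1 = 1 ∧
        (∀ v : QuarkVar Nf S, K (_root_.Literature.MathematicalPhysics.QuantumFieldTheory.q v) =
          -∑ σ : Fin 4, _root_.Literature.MathematicalPhysics.QuantumLattice.gammaFive σ v.2.2.2 •
            _root_.Literature.MathematicalPhysics.QuantumFieldTheory.qbar (v.1, (v.2.1, v.2.2.1, σ))) ∧
        (∀ v : QuarkVar Nf S, K (_root_.Literature.MathematicalPhysics.QuantumFieldTheory.qbar v) =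
          ∑ σ : Fin 4, _root_.Literature.MathematicalPhysics.QuantumLattice.gammaFive v.2.2.2 σ •
            _root_.Literature.MathematicalPhysics.QuantumFieldTheory.q (v.1, (v.2.1, v.2.2.1, σ))) := by
  intro Nf S _
  exact ⟨fun a => torusK a, torusK_mul, torusK_add, torusK_smul, torusK_one, torusK_q', torusK_qbar'⟩

end Summit.QuantumFields.QCD.Cruxes.TorusHalfSpectrum.Birth.GammaFiveConjExists

end
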